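import Summits.CriticalPhenomena.PercolationContinuityZ3.Theorems.Transplant.Slab111HubXCert
import HarnessLib

/-!
# The HUB ROUTING of the `(111)`-films, XXXIII-X: `linkage_of_certsX` — the swap pair at a block of a valid shape from its zone-free certificates

builds on p205010 (kernel theorem, internal audit signed; external expert review pending) — NOT used in this file.  Lane `prim-bschramm`, seat
`prim-bschramm-p2` (gen 37; class C1b; memo `HOME/bschramm/P2-LATTICES.md` §135); helper file (`--supports stmt-CriticalPhenomena-4575 --as helper`).
**`linkage_of_certsX`**: the zone-free analogue of «Slab111HubShapeLink4».`linkage_of_shape4` — for `k ≥ kmin`, a shape valid for the block type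
and a row certificate («Slab111HubXCert».`certRowOK`) for every pair of `E`-columns give the cleared set `WOf S k z` a swap pair for every certified
terminal triple, i.e. the conclusion of «HexShadowVRouteData».`ShapedLinkage 3` at the blocks of that type.  The `E`-columns of a shape: `ecolsOf`.
[cite: DuminilCopinSidoraviciusTassion2016, §2.3 (proof of Fact 2: the three disjoint paths γ_u, γ_v, γ_w in B_R(z))]
-/

noncomputable section

namespace Summit.CriticalPhenomena.PercolationContinuityZ3.Theorems.Transplant

open Literature.Probability.Percolation Literature.Probability.LatticeModels SimpleGraph
open scoped Classical

namespace Slab111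

variable {k : ℕ}

/-- The possible columns of an `E`-terminal: cleared, in the rerouting region, not the centre. [folklore] -/
def ecolsOf (S : ShapeB) : List (ℤ × ℤ) := S.cols.filter fun q => decide (q ≠ (0, 0)) && S.pcB q

/-- **THE SWAP PAIR AT A BLOCK OF A VALID SHAPE FROM ZONE-FREE CERTIFICATES** (`k ≥ kmin`). [folklore] -/
theorem linkage_of_certsX {kmin : ℤ} (hk : kmin ≤ (k : ℤ)) {S : ShapeB} {tR tD sR sD : ℕ} (hV : S.Valid tR tD sR sD)
    (hrows : ∀ q₁ ∈ ecolsOf S, ∀ q₂ ∈ ecolsOf S, ∃ (pool : List ℕ) (Ns : List (List ℕ)), certRowOK S kmin q₁ q₂ pool Ns = true) (z : Site 2) :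
    ∃ W : Set (slab111 k), (∀ x ∈ W, (hexShadow k).sh x ∈ blkR 3 z tD sD) ∧
      (∀ x, (hexShadow k).sh x ∈ hexBall z 1 → (hexShadow k).sh x ∈ blkR 3 z tD sD → x ∈ W) ∧
      ∀ (E₁ E₂ w' : slab111 k), (hexShadow k).Terminals 3 z tR tD sR W E₁ E₂ w' →
        ∃ r₁ r₂ : VRouteData (film k) (W ∩ (hexShadow k).lift (blkR 3 z tR sR)) W E₁ E₂ w', r₁.y = r₂.b ∧ r₁.b = r₂.y := by
  refine ⟨WOf S k z, WOf_subset_blkR hV z, fun x h1 hD => mem_WOf_of_hexBall_one hV z x h1 hD, ?_⟩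
  intro E₁ E₂ w' hT
  obtain ⟨hq1, hs1, -, -⟩ := member_factsG hT.E₁W
  obtain ⟨hq2, hs2, -, -⟩ := member_factsG hT.E₂W
  obtain ⟨hq3, hs3, -, -⟩ := member_factsG hT.w'W
  have hR1 : inBlkB tR sR (relC z E₁) = true := by have := hT.E₁R; rw [hexShadow_sh, sh_mem_blkR_iff] at this; exact this
  have hR2 : inBlkB tR sR (relC z E₂) = true := by have := hT.E₂R; rw [hexShadow_sh, sh_mem_blkR_iff] at this; exact this
  have hP1 : S.pcB (relC z E₁) = true := (hV.pcR _).2 ⟨hq1, hR1⟩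
  have hP2 : S.pcB (relC z E₂) = true := (hV.pcR _).2 ⟨hq2, hR2⟩
  have vz : vcol z ((0 : ℤ), (0 : ℤ)) = z := by ext i; fin_cases i <;> simp [vcol]
  have hq10 : relC z E₁ ≠ (0, 0) := fun e => hT.E₁z (show sh E₁ = z by rw [hs1, e, vz])
  have hq20 : relC z E₂ ≠ (0, 0) := fun e => hT.E₂z (show sh E₂ = z by rw [hs2, e, vz])
  have hq30 : relC z w' ≠ (0, 0) := fun e => hT.w'z (show sh w' = z by rw [hs3, e, vz])
  have hq31 : relC z w' ≠ relC z E₁ := relC_ne_of_sh_ne hT.w'E₁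
  have hq32 : relC z w' ≠ relC z E₂ := relC_ne_of_sh_ne hT.w'E₂
  have he1 : relC z E₁ ∈ ecolsOf S := by
    unfold ecolsOf; rw [List.mem_filter]; exact ⟨hV.colsList _ hq1, by simp [hq10, hP1]⟩
  have he2 : relC z E₂ ∈ ecolsOf S := by
    unfold ecolsOf; rw [List.mem_filter]; exact ⟨hV.colsList _ hq2, by simp [hq20, hP2]⟩
  have hw3 : relC z w' ∈ wcolsOf S (relC z E₁) (relC z E₂) := by
    unfold wcolsOf; rw [List.mem_filter]; exact ⟨hV.colsList _ hq3, by simp [hq30, hq31, hq32]⟩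
  obtain ⟨pool, Ns, hrow⟩ := hrows _ he1 _ he2
  obtain ⟨es, N, hN⟩ := certRowOK_sound hrow _ hw3
  exact certOK_swap hN hV hk z hT rfl rfl rfl

end Slab111

end Summit.CriticalPhenomena.PercolationContinuityZ3.Theorems.Transplant

end
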